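import Summits.BirchSwinnertonDyer.BirchSwinnertonDyer.Theorems.SignedLowerHalvesSprungLowerDivisibilityAtThreeCyclotomicLowerAtT
import Summits.BirchSwinnertonDyer.BirchSwinnertonDyer.Theorems.SignedLowerHalvesSprungLowerDivisibilityAtThreeStubPeriodMu
import Summits.BirchSwinnertonDyer.BirchSwinnertonDyer.Theorems.SignedLowerHalvesSprungLowerDivisibilityAtThreeOrderLeRankAtT
import HarnessLib

/-!
# Crux `SprungLowerDivisibilityAtThree` (item stmt-BirchSwinnertonDyer-19875), line `chromatic-common-zeros`:
# stub S4b `stub_cyclotomicLowerRest` SPLITS into its positive-level part and the signed `p`-adic BSD rank inequality at `r_an ≥ 2`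

Cell `bsd-ssimc` (host) / lead `cruxlead-stmt-BirchSwinnertonDyer-19875` (g2); `--supports` 19875 `--as helper`; theorems only; closes NO
item; no registry change (skeleton v7 keeps S4b whole); K1 / BSD / leaf X8 are NOT proved by anything here.

S4b asks, in K1's binder context for colour `•`, at a height-one `𝔭 ∋ ω_n` that is a common zero of every colour's normalised
`L`-function and is NOT `(T)`-in-analytic-rank-`≤ 1`, for `ℓ_𝔭 Λ/(G^•) ≤ ℓ_𝔭 X^•`. Such a `𝔭` is either `(T)` with `r_an ≥ 2`, or
`(Φ_{3^j}(1+T))` with `j ≥ 1` (w3's `ChromaticCommonZerosRankZero.exists_cyclotomic_comp_mem_of_omega_mem`). This file proves the DOOR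

  `S4b ⟸ S4b-cyc ∧ MinOrd`   (`stub_cyclotomicLowerRest_of_posLevel_of_minOrderLeRank`, modulo `h714`, `h3`),

where
* S4b-cyc = S4b restricted to `T ∉ 𝔭 ∋ Φ_{3^j}(1+T)`, `j ≥ 1` (the TWISTED residue: main-conjecture content at the cyclotomic primes of
  positive level; per pair reachable by rank growth in the first layers — w2 g2's level-1 door), and
* MinOrd = «on class X8 with `r_an ≥ 2`, for every newform and Sprung pair, SOME colour has `ord_{T=0} L^• ≤ rank E(ℚ)`» — a statement
  about `L♯, L♭` and the Mordell–Weil rank ONLY (no Selmer datum, no Coleman package): the hard direction of the signed `p`-adic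
  Birch–Swinnerton-Dyer rank prediction `min(ord L♯, ord L♭) = rank E(ℚ)` (Sprung 2015 §4–5 / Bernardi–Perrin-Riou) beyond Gross–Zagier–Kolyvagin;
  VACUOUS on the x8 census (all cells have `r_an ≤ 1`).
The `(T)`-branch is w3's every-rank door `ChromaticCommonZerosOrderLeRank.stub_cyclotomicLower_at_T_of_order_le_rank` (p610020: Kummer
brick `rank E(ℚ) ≤ ℓ_{(T)} X^•`, p608535) followed by the colour transfer of S4a's file (`lengthAt_quotient_le_of_otherColour`, p608649).

References: [Sprung2012] Thm. 7.14 (p. 1504), Prop. 7.19 (p. 1505); [Sprung2015] Conj. 4.7–4.8, Cor. 5.4; [BernardiPerrinRiou1993];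
[GreenbergLNM1716] §3 Lemma 3.1; tree: `…OrderLeRankAtT` (p610020), `…SharpFlatMordellWeilRank` (p608535), `…CyclotomicLowerAtT` (p608649),
`…RankZeroCommonZeros` (p607354), `…StubPeriodMu` (p606253).
-/

set_option linter.dupNamespace false
set_option autoImplicit false

noncomputable section

open scoped Classical NumberField MatrixGroups ModularForm

open NumberField IsDedekindDomain CongruenceSubgroup WeierstrassCurve Field
  Literature.NumberTheory.EllipticCurves Literature.NumberTheory.EllipticCurves.ModularForms
  Literature.NumberTheory.EllipticCurves.ZpExtension Literature.NumberTheory.EllipticCurves.Sprung2017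
  Literature.NumberTheory.EllipticCurves.Sprung2012 Literature.NumberTheory.EllipticCurves.Rank1Residual
  Literature.NumberTheory.EllipticCurves.IwasawaAlgebra
  Summit.BirchSwinnertonDyer.BirchSwinnertonDyer.Theorems
  Summit.BirchSwinnertonDyer.Rank1Residual.Supersingular

namespace Summit.BirchSwinnertonDyer.BirchSwinnertonDyer.Theorems.ChromaticCommonZeros

/-! ### §1 The `(T)`-branch of S4b at EVERY rank, from «some colour has `ord_T L ≤ rank E(ℚ)`» -/

/-- **S4b at `𝔭 ∋ T` from `∃ •₁, ord_{T=0} L^{•₁} ≤ rank E(ℚ)`** (every analytic rank). In K1's binder context for colour `•` on class X8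
(dual datum `D` finitely generated torsion, normalised `G`, joint packages `Cs, Cf` with `Cs.Z = Cf.Z`), at a height-one `𝔭 ∋ T`: if SOME
colour `•₁` has `ord_{T=0} L^{•₁} ≤ rank E(ℚ)` (so `L^{•₁} ≠ 0`), then `ℓ_𝔭 Λ/(G) ≤ ℓ_𝔭 D.X` — for `•₁` by w3's door (p610020: Kummer brick,
no GZK, no Kato) on a real dual datum of colour `•₁` (finitely generated torsion by Thm. 7.14), then moved to `•` by the colour transfer.
CONDITIONAL on the displayed named facts `h714` (Sprung 2012 Thm. 7.14) and `h3` (period unit at 3, for the normalised `G₁`).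
[cite: Sprung2012, Thm. 7.14 (p. 1504), Prop. 7.19 (p. 1505)] [cite: GreenbergLNM1716, §3 Lemma 3.1] -/
theorem stub_cyclotomicLowerAtT_of_minOrderLeRank (h714 : thm714_sharpFlatSelmerDual_finite_torsion)
    (h3 : realPeriodRat_eq_unit_mul_plusPeriod_three)
    (W : WeierstrassCurve ℚ) [W.IsElliptic] [W.IsGloballyMinimal] (p : ℕ) [Fact p.Prime]
    [ContinuousSMul ℤ_[p] (W.tateModule p)] [Module.Free ℤ_[p] (W.tateModule p)]
    [Module.Finite ℤ_[p] (W.tateModule p)]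
    (hX : ClassX8 W p) (col : Chroma) (κ : ZpExtension ℚ p) (γ : Field.absoluteGaloisGroup ℚ)
    (hκ : κ.IsCyclotomic) (hγ : κ.IsTopGenerator γ) (hcv : IsCyclotomicVariable p γ)
    (v : HeightOneSpectrum (𝓞 ℚ)) (hv : (p : 𝓞 ℚ) ∈ v.asIdeal)
    (g : Field.absoluteGaloisGroup (v.adicCompletion ℚ))
    (hg : κ.IsTopGenerator (resGalOfEmb (closureEmb (K := ℚ) (v.adicCompletion ℚ)) g))
    (cneg : localPoints W (v.adicCompletion ℚ)) (c : ℕ → localPoints W (v.adicCompletion ℚ))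
    (hH : IsHondaSystem κ (closureEmb (K := ℚ) (v.adicCompletion ℚ)) W (W.frobeniusTrace p) g cneg c)
    (N : ℕ) (hN : NeZero N) (f : CuspForm (Gamma0 N) 2) (ϖ : ℚ) (Lsharp Lflat : IwasawaAlgebra p)
    (hf : IsNewformOf W f) (hϖ : (ϖ : ℝ) * W.realPeriodRat = plusPeriod f)
    (hSP : IsSprungPair f p (W.frobeniusTrace p) Lsharp Lflat) (hcol : chromaticL col Lsharp Lflat ≠ 0)
    (D : SharpFlatSelmerDualData W κ γ (closureEmb (K := ℚ) (v.adicCompletion ℚ)) (W.frobeniusTrace p) g c col)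
    [Module.Finite (IwasawaAlgebra p) D.X] (hXt : Module.IsTorsion (IwasawaAlgebra p) D.X)
    (G : IwasawaAlgebra p)
    (hG : iwasawaToPowerSeries p G = PowerSeries.C (ϖ : ℚ_[p]) * iwasawaToPowerSeries p (chromaticL col Lsharp Lflat))
    (I : Kato2004.IwasawaH1Data W p κ γ)
    (Cs : SharpFlatColemanKatoData W p f ϖ κ γ (closureEmb (K := ℚ) (v.adicCompletion ℚ)) (W.frobeniusTrace p) g c
      Chroma.sharp I)
    (Cf : SharpFlatColemanKatoData W p f ϖ κ γ (closureEmb (K := ℚ) (v.adicCompletion ℚ)) (W.frobeniusTrace p) g c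
      Chroma.flat I)
    (hZ : Cs.Z = Cf.Z) (𝔭 : PrimeSpectrum (IwasawaAlgebra p)) (h𝔭 : 𝔭.asIdeal.height = 1)
    (hT : (PowerSeries.X : IwasawaAlgebra p) ∈ 𝔭.asIdeal)
    (hmin : ∃ c₁ : Chroma, (chromaticL c₁ Lsharp Lflat).order ≤ (W.mordellWeilRank : ℕ∞)) :
    Module.lengthAt (IwasawaAlgebra p) (IwasawaAlgebra p ⧸ Ideal.span {G}) 𝔭 ≤
      Module.lengthAt (IwasawaAlgebra p) D.X 𝔭 := by
  classical
  haveI : NeZero N := hN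
  obtain ⟨hp3, ⟨hgood, hap⟩, -⟩ := id hX
  subst hp3
  have hp2 : (3 : ℕ) ≠ 2 := by decide
  have hirr : W.HasIrreducibleModPGaloisRep 3 :=
    hasIrreducibleModPGaloisRep_of_dvd_frobeniusTrace W 3 hp2
      (W.not_dvd_minimalDiscriminantInt_of_hasGoodReductionAtPrime' 3 hgood) hap
  obtain ⟨c₁, hord⟩ := hmin
  -- the chosen colour is non-zero (its order is finite)
  have hcol₁ : chromaticL c₁ Lsharp Lflat ≠ 0 := by
    intro h0
    rw [h0, PowerSeries.order_zero, top_le_iff] at hord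
    exact ENat.coe_ne_top _ hord
  -- a normalised generator for the colour `c₁` (period unit at 3)
  obtain ⟨hGall, -⟩ := stub_periodMu h3 W 3 hX N hN f ϖ Lsharp Lflat hf hϖ hSP
  obtain ⟨G₁, hG₁⟩ := hGall c₁
  have hϖ0 : ϖ ≠ 0 := hf.periodRatio_ne_zero hϖ
  have hG₁0 : G₁ ≠ 0 := by
    intro h0
    rw [h0, map_zero, eq_comm, mul_eq_zero] at hG₁
    rcases hG₁ with hC | hL
    · have h1 : ((ϖ : ℚ) : ℚ_[3]) = 0 := by simpa using congrArg PowerSeries.constantCoeff hC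
      exact hϖ0 (by exact_mod_cast h1)
    · exact hcol₁ (iwasawaToPowerSeries_injective 3 (by rw [hL, map_zero]))
  -- w3's every-rank door for a dual datum of colour `c₁`
  have hdoor : ∀ (D₁ : SharpFlatSelmerDualData W κ γ (closureEmb (K := ℚ) (v.adicCompletion ℚ))
      (W.frobeniusTrace 3) g c c₁) [Module.Finite (IwasawaAlgebra 3) D₁.X],
      Module.lengthAt (IwasawaAlgebra 3) (IwasawaAlgebra 3 ⧸ Ideal.span {G₁}) 𝔭 ≤
        Module.lengthAt (IwasawaAlgebra 3) D₁.X 𝔭 :=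
    fun D₁ _ => ChromaticCommonZerosOrderLeRank.stub_cyclotomicLower_at_T_of_order_le_rank 3 W hp2 hap hγ hg hH hf hϖ
      c₁ hcol₁ D₁ hG₁ hord 𝔭 h𝔭 hT
  by_cases hcc : c₁ = col
  · -- same colour
    subst hcc
    have hGG : G = G₁ := iwasawaToPowerSeries_injective 3 (by rw [hG, hG₁])
    rw [hGG]
    exact hdoor D
  · -- other colour: Thm. 7.14 for a real datum of colour `c₁`, then the colour transfer
    obtain ⟨D₁⟩ := nonempty_sharpFlatSelmerDualData_rat W κ γ v g c c₁
    obtain ⟨hfin₁, -⟩ :=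
      h714 W 3 hp2 hgood hap f hf κ γ hκ hγ hcv v hv g hg cneg c hH c₁ Lsharp Lflat hSP hcol₁ D₁
    haveI := hfin₁
    have h₁ := hdoor D₁
    obtain ⟨C, C', hZZ⟩ : ∃ (C : SharpFlatColemanKatoData W 3 f ϖ κ γ
          (closureEmb (K := ℚ) (v.adicCompletion ℚ)) (W.frobeniusTrace 3) g c col I)
        (C' : SharpFlatColemanKatoData W 3 f ϖ κ γ
          (closureEmb (K := ℚ) (v.adicCompletion ℚ)) (W.frobeniusTrace 3) g c c₁ I),
        C.Z = C'.Z := by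
      cases col <;> cases c₁
      · exact absurd rfl hcc
      · exact ⟨Cs, Cf, hZ⟩
      · exact ⟨Cf, Cs, hZ.symm⟩
      · exact absurd rfl hcc
    exact lengthAt_quotient_le_of_otherColour W 3 hγ C C' hZZ hirr hSP hcol hcol₁ hG hG₁ hG₁0 D D₁ 𝔭 h𝔭 h₁

/-! ### §2 The split door: S4b ⟸ S4b-cyc ∧ MinOrd -/

/-- **Stub S4b `stub_cyclotomicLowerRest` from its positive-level part and the signed `p`-adic BSD rank inequality at `r_an ≥ 2`.**
`hCyc` = S4b VERBATIM except that the cyclotomic hypothesis reads «`T ∉ 𝔭` and `Φ_{3^j}(1+T) ∈ 𝔭` for some `j ≥ 1`» (the twisted residue);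
`hMinOrd` = «X8, `1 < r_an`: for every newform and Sprung pair, `∃ •, ord_{T=0} L^• ≤ rank E(ℚ)`» (no Selmer datum; vacuous on every
pair with `r_an ≤ 1`). At a height-one `𝔭 ∋ ω_n` with `¬(T ∈ 𝔭 ∧ r_an ≤ 1)`: if `T ∈ 𝔭` then `r_an ≥ 2` and §1 applies; otherwise
`Φ_{3^j}(1+T) ∈ 𝔭` for some `1 ≤ j ≤ n` (`exists_cyclotomic_comp_mem_of_omega_mem`) and `hCyc` applies. CONDITIONAL on `h714`, `h3`
(displayed); closes nothing; S4b stays the registered stub. [cite: Sprung2012, Thm. 7.14 (p. 1504), Prop. 7.19 and Main Conj. 7.21 (p. 1505)]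
[cite: Sprung2015, Conj. 4.8 and Cor. 5.4] -/
theorem stub_cyclotomicLowerRest_of_posLevel_of_minOrderLeRank (h714 : thm714_sharpFlatSelmerDual_finite_torsion)
    (h3 : realPeriodRat_eq_unit_mul_plusPeriod_three)
    (hCyc :
      ∀ (W : WeierstrassCurve ℚ) [W.IsElliptic] [W.IsGloballyMinimal] (p : ℕ) [Fact p.Prime]
        [ContinuousSMul ℤ_[p] (W.tateModule p)] [Module.Free ℤ_[p] (W.tateModule p)]
        [Module.Finite ℤ_[p] (W.tateModule p)],
        ClassX8 W p → ∀ (col : Chroma) (κ : ZpExtension ℚ p) (γ : Field.absoluteGaloisGroup ℚ),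
        κ.IsCyclotomic → κ.IsTopGenerator γ → IsCyclotomicVariable p γ →
      ∀ (v : HeightOneSpectrum (𝓞 ℚ)), (p : 𝓞 ℚ) ∈ v.asIdeal →
      ∀ (g : Field.absoluteGaloisGroup (v.adicCompletion ℚ)),
        κ.IsTopGenerator (resGalOfEmb (closureEmb (K := ℚ) (v.adicCompletion ℚ)) g) →
      ∀ (cneg : localPoints W (v.adicCompletion ℚ)) (c : ℕ → localPoints W (v.adicCompletion ℚ)),
        IsHondaSystem κ (closureEmb (K := ℚ) (v.adicCompletion ℚ)) W (W.frobeniusTrace p) g cneg c →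
      ∀ (N : ℕ) (_ : NeZero N) (f : CuspForm (Gamma0 N) 2) (ϖ : ℚ) (Lsharp Lflat : IwasawaAlgebra p),
        IsNewformOf W f → (ϖ : ℝ) * W.realPeriodRat = plusPeriod f →
        IsSprungPair f p (W.frobeniusTrace p) Lsharp Lflat → chromaticL col Lsharp Lflat ≠ 0 →
      ∀ (D : SharpFlatSelmerDualData W κ γ (closureEmb (K := ℚ) (v.adicCompletion ℚ))
          (W.frobeniusTrace p) g c col) [Module.Finite (IwasawaAlgebra p) D.X],
        Module.IsTorsion (IwasawaAlgebra p) D.X →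
      ∀ (G : IwasawaAlgebra p),
        iwasawaToPowerSeries p G =
          PowerSeries.C (ϖ : ℚ_[p]) * iwasawaToPowerSeries p (chromaticL col Lsharp Lflat) →
      ∀ (I : Kato2004.IwasawaH1Data W p κ γ)
        (Cs : SharpFlatColemanKatoData W p f ϖ κ γ (closureEmb (K := ℚ) (v.adicCompletion ℚ))
          (W.frobeniusTrace p) g c Chroma.sharp I)
        (Cf : SharpFlatColemanKatoData W p f ϖ κ γ (closureEmb (K := ℚ) (v.adicCompletion ℚ))
          (W.frobeniusTrace p) g c Chroma.flat I),
        Cs.Z = Cf.Z →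
      ∀ 𝔭 : PrimeSpectrum (IwasawaAlgebra p), 𝔭.asIdeal.height = 1 →
        (PowerSeries.X : IwasawaAlgebra p) ∉ 𝔭.asIdeal →
        (∃ j : ℕ, 1 ≤ j ∧
          ((((Polynomial.cyclotomic (p ^ j) ℤ).comp (Polynomial.X + 1)).map (Int.castRingHom ℤ_[p]) : Polynomial ℤ_[p]) :
            PowerSeries ℤ_[p]) ∈ 𝔭.asIdeal) →
        (∀ (col' : Chroma) (G' : IwasawaAlgebra p),
          iwasawaToPowerSeries p G' =
            PowerSeries.C (ϖ : ℚ_[p]) * iwasawaToPowerSeries p (chromaticL col' Lsharp Lflat) →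
          G' ∈ 𝔭.asIdeal) →
        Module.lengthAt (IwasawaAlgebra p) (IwasawaAlgebra p ⧸ Ideal.span {G}) 𝔭 ≤
          Module.lengthAt (IwasawaAlgebra p) D.X 𝔭)
    (hMinOrd :
      ∀ (W : WeierstrassCurve ℚ) [W.IsElliptic] [W.IsGloballyMinimal] (p : ℕ) [Fact p.Prime],
        ClassX8 W p → 1 < W.analyticRank → ∀ (N : ℕ) (_ : NeZero N) (f : CuspForm (Gamma0 N) 2)
          (Lsharp Lflat : IwasawaAlgebra p),
        IsNewformOf W f → IsSprungPair f p (W.frobeniusTrace p) Lsharp Lflat →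
        ∃ c₁ : Chroma, (chromaticL c₁ Lsharp Lflat).order ≤ (W.mordellWeilRank : ℕ∞)) :
    ∀ (W : WeierstrassCurve ℚ) [W.IsElliptic] [W.IsGloballyMinimal] (p : ℕ) [Fact p.Prime]
      [ContinuousSMul ℤ_[p] (W.tateModule p)] [Module.Free ℤ_[p] (W.tateModule p)]
      [Module.Finite ℤ_[p] (W.tateModule p)],
      ClassX8 W p → ∀ (col : Chroma) (κ : ZpExtension ℚ p) (γ : Field.absoluteGaloisGroup ℚ),
      κ.IsCyclotomic → κ.IsTopGenerator γ → IsCyclotomicVariable p γ →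
    ∀ (v : HeightOneSpectrum (𝓞 ℚ)), (p : 𝓞 ℚ) ∈ v.asIdeal →
    ∀ (g : Field.absoluteGaloisGroup (v.adicCompletion ℚ)),
      κ.IsTopGenerator (resGalOfEmb (closureEmb (K := ℚ) (v.adicCompletion ℚ)) g) →
    ∀ (cneg : localPoints W (v.adicCompletion ℚ)) (c : ℕ → localPoints W (v.adicCompletion ℚ)),
      IsHondaSystem κ (closureEmb (K := ℚ) (v.adicCompletion ℚ)) W (W.frobeniusTrace p) g cneg c →
    ∀ (N : ℕ) (_ : NeZero N) (f : CuspForm (Gamma0 N) 2) (ϖ : ℚ) (Lsharp Lflat : IwasawaAlgebra p),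
      IsNewformOf W f → (ϖ : ℝ) * W.realPeriodRat = plusPeriod f →
      IsSprungPair f p (W.frobeniusTrace p) Lsharp Lflat → chromaticL col Lsharp Lflat ≠ 0 →
    ∀ (D : SharpFlatSelmerDualData W κ γ (closureEmb (K := ℚ) (v.adicCompletion ℚ))
        (W.frobeniusTrace p) g c col) [Module.Finite (IwasawaAlgebra p) D.X],
      Module.IsTorsion (IwasawaAlgebra p) D.X →
    ∀ (G : IwasawaAlgebra p),
      iwasawaToPowerSeries p G =
        PowerSeries.C (ϖ : ℚ_[p]) * iwasawaToPowerSeries p (chromaticL col Lsharp Lflat) →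
    ∀ (I : Kato2004.IwasawaH1Data W p κ γ)
      (Cs : SharpFlatColemanKatoData W p f ϖ κ γ (closureEmb (K := ℚ) (v.adicCompletion ℚ))
        (W.frobeniusTrace p) g c Chroma.sharp I)
      (Cf : SharpFlatColemanKatoData W p f ϖ κ γ (closureEmb (K := ℚ) (v.adicCompletion ℚ))
        (W.frobeniusTrace p) g c Chroma.flat I),
      Cs.Z = Cf.Z →
    ∀ 𝔭 : PrimeSpectrum (IwasawaAlgebra p), 𝔭.asIdeal.height = 1 →
      (∃ n : ℕ, ((cyclotomicOmega p n).map (Int.castRingHom ℤ_[p]) : PowerSeries ℤ_[p]) ∈ 𝔭.asIdeal) →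
      ¬ ((PowerSeries.X : IwasawaAlgebra p) ∈ 𝔭.asIdeal ∧ W.analyticRank ≤ 1) →
      (∀ (col' : Chroma) (G' : IwasawaAlgebra p),
        iwasawaToPowerSeries p G' =
          PowerSeries.C (ϖ : ℚ_[p]) * iwasawaToPowerSeries p (chromaticL col' Lsharp Lflat) →
        G' ∈ 𝔭.asIdeal) →
      Module.lengthAt (IwasawaAlgebra p) (IwasawaAlgebra p ⧸ Ideal.span {G}) 𝔭 ≤
        Module.lengthAt (IwasawaAlgebra p) D.X 𝔭 := by
  intro W _ _ p _ _ _ _ hX col κ γ hκ hγ hcv v hv g hg cneg c hH N hN f ϖ Lsharp Lflat hf hϖ hSP hcol D _ hXt G hG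
    I Cs Cf hZ 𝔭 h𝔭 hcyc hTr hcommon
  by_cases hT : (PowerSeries.X : IwasawaAlgebra p) ∈ 𝔭.asIdeal
  · -- `𝔭 = (T)` with `r_an ≥ 2`
    have hr : 1 < W.analyticRank := by
      by_contra hle
      exact hTr ⟨hT, Nat.not_lt.mp hle⟩
    exact stub_cyclotomicLowerAtT_of_minOrderLeRank h714 h3 W p hX col κ γ hκ hγ hcv v hv g hg cneg c hH N hN f ϖ Lsharp
      Lflat hf hϖ hSP hcol D hXt G hG I Cs Cf hZ 𝔭 h𝔭 hT (hMinOrd W p hX hr N hN f Lsharp Lflat hf hSP)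
  · -- a cyclotomic prime of positive level
    obtain ⟨n, hω⟩ := hcyc
    obtain ⟨j, hj1, -, hΦ⟩ := ChromaticCommonZerosRankZero.exists_cyclotomic_comp_mem_of_omega_mem p 𝔭 n hω hT
    exact hCyc W p hX col κ γ hκ hγ hcv v hv g hg cneg c hH N hN f ϖ Lsharp Lflat hf hϖ hSP hcol D hXt G hG I Cs Cf hZ
      𝔭 h𝔭 hT ⟨j, hj1, hΦ⟩ hcommon

end Summit.BirchSwinnertonDyer.BirchSwinnertonDyer.Theorems.ChromaticCommonZeros

end
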